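import Literature.NumberTheory.ComplexMultiplication.CMOrderKummerDedekindCriterion
import HarnessLib

/-!
# Validation on `ℤ[√-3] = ℤ[2ζ₃] ⊂ ℤ[ζ₃]`: singular exactly above `2`, Kummer–Dedekind at every odd prime

Layer A3 of the Hodge/CM programme (docs/m5/MAPPING.md §1): the running example of the "arbitrary order" series
(`𝔯 = endOrder (M_{(1, 2ζ₃)}) = ℤ[2ζ₃] = ℤ[√-3]`, index `2`, conductor `2𝓞_K`, `CMOrderConductor`, `CMOrderDiscriminant §4`,
`CMOrderFiniteIndexSubrings §8`) run through `CMOrderSingularPrimesIndex` / `CMOrderKummerDedekindCriterion`: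

* `dvd_index_basis_iff` (`p ∣ [ℤ[ζ₃] : ℤ[√-3]] ⟺ p = 2`), **`setOf_prime_singular_basis_eq`** (`ℤ[√-3]` is singular above
  `p` iff `p = 2`), `conductor_basis_sup_span_eq_top` (`𝔣 + p𝓞_K = 𝓞_K` for odd `p`: Kummer–Dedekind applies),
  `not_conductor_basis_sup_span_two_eq_top`;
* **`exponent_twoMulZeta_eq_two`** (Mathlib's `RingOfIntegers.exponent (2ζ₃) = 2`: it divides the index `2` and is not `1`
  since `𝔣 ≠ (1)`), `natCard_primesOver_eq_card_monicFactorsMod_basis` (for odd `p`, the primes of `ℤ[ζ₃]` above `p`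
  ↔ the monic irreducible factors of `X² + 2X + 4 mod p`).

Theorems only (no new definitions, no named facts).

## References
* [Stevenhagen2008NumberRings] P. Stevenhagen, *The arithmetic of number rings*, MSRI Publ. 44 (2008) — Example 6.9 («the
  order `R = ℤ[√-3]` of index 2 in `𝒪 = ℤ[ω]` … `𝔣_R = 2𝒪`»), p. 226; §8 Thm. 8.2 and p. 231.
* [Cox2013] D. A. Cox, *Primes of the form x² + ny²*, 2nd ed. — §7.A Lemma 7.2, p. 133.
-/

noncomputable section

open scoped Classical nonZeroDivisors NumberField
open NumberField Module

namespace Literature.NumberTheory.ComplexMultiplication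

namespace CMTypeLattice

namespace EisensteinTwo

/-- `p ∣ [ℤ[ζ₃] : ℤ[√-3]] = 2 ⟺ p = 2` (`p` prime). [cite: Stevenhagen2008NumberRings, Example 6.9, p. 226] -/
theorem dvd_index_basis_iff {p : ℕ} (hp : p.Prime) :
    p ∣ (EndOrder.toRingOfIntegers (Algebra.leftMulMatrix basis)).range.toAddSubgroup.index ↔ p = 2 := by
  rw [index_range_toRingOfIntegers_eq_two]
  exact Nat.prime_dvd_prime_iff_eq hp Nat.prime_two

/-- **`ℤ[√-3]` is singular above `p` iff `p = 2`.** [cite: Stevenhagen2008NumberRings, Example 6.9 («of index 2 … `𝔣_R = 2𝒪`»),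
p. 226; §8 Thm. 8.5, p. 236] -/
theorem setOf_prime_singular_basis_eq :
    {p : ℕ | p.Prime ∧ ∃ 𝔭 : Ideal (endOrder (Algebra.leftMulMatrix basis)), 𝔭.IsPrime ∧
      EndOrder.conductorIdeal (Algebra.leftMulMatrix basis) ≤ 𝔭 ∧ (p : endOrder (Algebra.leftMulMatrix basis)) ∈ 𝔭} =
      {2} := by
  rw [EndOrder.setOf_prime_singular_eq_primeFactors_index, index_range_toRingOfIntegers_eq_two,
    Nat.Prime.primeFactors Nat.prime_two, Finset.coe_singleton]

/-- **Kummer–Dedekind applies to `ℤ[√-3]` at every odd prime**: `𝔣 + p𝓞_K = 𝓞_K` for `p ≠ 2`.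
[cite: Stevenhagen2008NumberRings, §8, p. 231; Example 6.9, p. 226] -/
theorem conductor_basis_sup_span_eq_top {p : ℕ} (hp : p.Prime) (hp2 : p ≠ 2) :
    EndOrder.conductor (Algebra.leftMulMatrix basis) ⊔ Ideal.span {(p : 𝓞 K₃)} = ⊤ :=
  (EndOrder.conductor_sup_span_eq_top_iff_not_dvd_index hp).2 fun h => hp2 ((dvd_index_basis_iff hp).1 h)

/-- … but not at `p = 2` (`𝔣 = 2𝓞_K`). [cite: Stevenhagen2008NumberRings, Example 6.9, p. 226] -/
theorem not_conductor_basis_sup_span_two_eq_top :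
    EndOrder.conductor (Algebra.leftMulMatrix basis) ⊔ Ideal.span {(2 : 𝓞 K₃)} ≠ ⊤ := fun h =>
  (EndOrder.conductor_sup_span_eq_top_iff_not_dvd_index (ρ := Algebra.leftMulMatrix basis) Nat.prime_two).1
    (by exact_mod_cast h) ((dvd_index_basis_iff Nat.prime_two).2 rfl)

/-- **Mathlib's `RingOfIntegers.exponent (2ζ₃) = 2`**: it divides the index `2` (`exponent_dvd_index`) and is not `1`,
since `𝔣 = 2𝓞_K ≠ 𝓞_K` (`CMOrderConductor.conductor_basis_ne_top`, `CMOrderFiniteIndexSubrings.conductor_basis_eq_conductor`).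
[cite: Stevenhagen2008NumberRings, Example 6.9, p. 226] [cite: Cox2013, §7.A Lemma 7.2, p. 133] -/
theorem exponent_twoMulZeta_eq_two :
    RingOfIntegers.exponent (⟨2 * zeta, isIntegral_twoMulZeta⟩ : 𝓞 K₃) = 2 := by
  have hdvd := EndOrder.exponent_dvd_index (ρ := Algebra.leftMulMatrix basis)
    (x := ⟨2 * zeta, isIntegral_twoMulZeta⟩) endOrder_basis_eq_adjoin
  rw [index_range_toRingOfIntegers_eq_two] at hdvd
  rcases (Nat.dvd_prime Nat.prime_two).1 hdvd with h1 | h2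
  · exfalso
    refine conductor_basis_ne_top ?_
    rw [conductor_basis_eq_conductor]
    rw [RingOfIntegers.exponent, Ideal.absNorm_eq_one_iff, Ideal.under_def, Ideal.comap_eq_top_iff] at h1
    exact h1
  · exact h2

/-- **Kummer–Dedekind for `ℤ[√-3]` at an odd prime `p`**: the primes of `ℤ[ζ₃]` above `p` correspond to the monic
irreducible factors of the minimal polynomial `X² + 2X + 4` of `2ζ₃` modulo `p` (their numbers agree).
[cite: Stevenhagen2008NumberRings, §8 Thm. 8.2, pp. 231–232] -/
theorem natCard_primesOver_eq_card_monicFactorsMod_basis {p : ℕ} [hp : Fact p.Prime] (hp2 : p ≠ 2) :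
    Nat.card ((Ideal.span {(p : ℤ)}).primesOver (𝓞 K₃)) =
      (RingOfIntegers.monicFactorsMod (⟨2 * zeta, isIntegral_twoMulZeta⟩ : 𝓞 K₃) p).card :=
  EndOrder.natCard_primesOver_eq_card_monicFactorsMod (ρ := Algebra.leftMulMatrix basis)
    (x := ⟨2 * zeta, isIntegral_twoMulZeta⟩) endOrder_basis_eq_adjoin fun h => hp2 ((dvd_index_basis_iff hp.out).1 h)

end EisensteinTwo

end CMTypeLattice

end Literature.NumberTheory.ComplexMultiplication
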